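import Literature.MathematicalPhysics.QuantumFieldTheory.Balaban1983to89.Node00.RStepSlotOfRecord
import Literature.MathematicalPhysics.QuantumFieldTheory.Balaban1983to89.B15FibreLemmaSupp

/-!
# NODE 00 — DEFINER ₇ (R-side), FILE 9′: `R` of record GENERIC IN THE PROVISO FORM; v1.2 = THE SUPPORT FORM (the ₇ plug of record)

DEF-R CAVEAT (R-C1) ∕ FLAG (R-C2) (pub-ymgap INBOX [NODE00-DEF-R-G0-CUT-FOR-N10B], dag-lead [FLAG-(R-C2)-VACUITY], director LINE №33,
chair R446 (A)): b01's PROVED (0.4) chain is consumed through the last conjunct of `B15RopTotal.RepData.Provisos`, *«every denominator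
fibre integral `∫dV′⌈_{Z′} ρ(Z″, V′, V)` nowhere zero»* — at EVERY base point `V`.  For genuine (2.18) data with INDICATOR characteristic
functions this fails off the support of `χ(s″)`'s constraints (dag-n12-a's `not_forall_fibreIntegral_indicatorOuter_ne_zero`): harmless in
print (`0 · (0 ∕ 0)`), but it makes `Provisos`, hence `AdmissibleAE`, FALSE there and `R` of record v1.1 (`ROp03AEOfRecord`, FILE 6) the
identity branch.  Print's proviso, [IV] p. 176 verbatim: *«the densities are positive, and the in[t]egration domains in the integrals above
are nonempty, hence the denominators are positive»* — a statement about the SUPPORT.  The support form of the fibre lemma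
(`RepData.ProvisosSupp`, `integral_rop_eq_of_provisosSupp`, `integrable_normTerm_supp`) was typed by dag-n10-b (`B15FibreLemmaSupp`, p416095);
its pointwise-total operator twin `ropTotalSupp` by dag-n12-b (`B15RopTotalSupp`, p418338; not imported here — this file is the A.E. pin
layer, as FILE 6 `ropTotalAE` is to `ropTotal`: the transported density is an `rnDeriv` version, chair R437 (2)).

THIS FILE makes the R-side pin INDEPENDENT of which proviso form is finally used and NAMES the plug.  A **`ProvisoForm P j G`** is a predicate
on b01's `RepData` together with the two certificates the totalised `R` consumes — (0.4) for the datum (`∫ d.rop = ∫ d.total`) and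
integrability of `d.rop`.  b01's printed-as-typed provisos give `ProvisoForm.std` (certificates = b01's proved `integral_ropReal_eq` ∕
`integrable_normTerm`); dag-n10-b's support form gives **`ProvisoForm.supp`** (certificates: their proved `integral_rop_eq_of_provisosSupp` and
the finite sum of `integrable_normTerm_supp`).  Over a form `Φ`: `AdmissibleBy Φ rep ρ :↔ (rep ρ).total =ᵐ ρ ∧ Φ.Prov (rep ρ)`, the total
operator `ropTotalBy Φ rep` ((0.3) on the admissible branch, the identity elsewhere), (0.4) and integrability FOR EVERY DENSITY, the NODE 00
pins `ROp03ByOfRecord Φ rep p k` in the shapes of `Residual₅.R ∕ .preservesIntegral_R ∕ .integrable_R`, `ROp03ByOfRecord (ProvisoFormOfRecord.std)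
= ROp03AEOfRecord` (`rfl`: v1.1 IS the standard form), and **THE ₇ PLUG OF RECORD** (def-R's word, pub-ymgap INBOX [NODE00-DEF-R-G2-ONLINE] (1)):
`R := ROp03SuppOfRecord F N rep` (`= ROp03ByOfRecord (ProvisoFormOfRecord.supp) rep`), `preservesIntegral_R := preservesIntegral_ROp03SuppOfRecord
F N rep`, `integrable_R := integrable_ROp03SuppOfRecord F N rep`; §5 gives its tower faces under `ProvisosSupp` of the tower datum, and the
binder-form twins of the FILE 5 ∕ FILE 8 faces.

INSTANCE CONVENTION (TS-8, F1 — dag-n11-a's diamond `DecidableEq (PBond P j)`: `Classical.propDecidable` vs the `Record5` cone's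
`instDecidableEqPBond`).  (i) The generic layer (§1–§2) is stated under BINDERS `[DecidableEq (PBond P j)]` (`ProvisoForm` is parameterised
by the instance `d.rop` reads); `open Classical in` is used only where an `if` over a `Prop` needs `Classical.propDecidable`.  (ii) The
TERMS of record (§3: `ProvisoFormOfRecord`, `ROp03ByOfRecord`, `ROp03SuppOfRecord`; like FILE 6 `ROp03AEOfRecord`, FILE 8 `rstepSlotOfRecord`,
FILE 5 `repOfRecordAE`) have instance-FREE types and classical bodies, so every importer denotes the same term and `Residual.R := …` needs no
bridge.  (iii) Every HYPOTHESIS-bearing consumer face (§5) carries the binder `[DecidableEq (PBond (F.P p.K) _)]` = the consumer's own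
instance; the proofs transport along §0's explicit-instance lemmas `…_instIrrel (i₁ i₂ : DecidableEq (PBond P j))` (`cases Subsingleton.elim
i₁ i₂; rfl` — the mechanism behind node00-def-T's `convert` bridge), so consumers close by `exact`.

HONEST FRAMING.  Definitions of record + bookkeeping; the certificates of `ProvisoForm.std` ∕ `.supp` are b01's ∕ dag-n10-b's PROVED
theorems; any other form's certificates are supplied by whoever constructs it; nothing of Bałaban's is asserted (no provisos, no (1.1) ∕
(1.2), no estimate) — in particular NO object of record is claimed to satisfy `ProvisosSupp`.  Counts unmoved by this; nothing continuum ∕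
ℝ⁴ ∕ OS ∕ mass-gap ∕ Clay.  No `sorry` ∕ `axiom` ∕ `opaque` ∕ `instance` ∕ `notation`.
-/

noncomputable section

namespace Literature.MathematicalPhysics.QuantumFieldTheory.Balaban1983to89.Node00

open MeasureTheory
open scoped BigOperators
open T4Continuum B15RopTotal
open B15.BasicStep (fibreIntegral normTerm RopReal)

/-! ## §0  Instance transport for `DecidableEq (PBond P j)` (TS-8) -/

section InstIrrel

variable {P : Params} {j : ℕ} {G : Type*} [GaugeGroup G] [MeasurableSpace G] [HaarData G]

/-- `RepData.Provisos` does not depend on the `DecidableEq (PBond P j)` instance (a subsingleton). [cite: Balaban1989LargeFieldI, (0.3) p.176 (bookkeeping)] -/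
theorem provisos_instIrrel (i₁ i₂ : DecidableEq (PBond P j)) (d : RepData P j G) :
    (haveI := i₁; d.Provisos) ↔ (haveI := i₂; d.Provisos) := by
  cases Subsingleton.elim i₁ i₂
  exact Iff.rfl

/-- `RepData.ProvisosSupp` does not depend on the instance. [cite: Balaban1989LargeFieldI, (0.3) p.176 (bookkeeping)] -/
theorem provisosSupp_instIrrel (i₁ i₂ : DecidableEq (PBond P j)) (d : RepData P j G) :
    (haveI := i₁; d.ProvisosSupp) ↔ (haveI := i₂; d.ProvisosSupp) := by
  cases Subsingleton.elim i₁ i₂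
  exact Iff.rfl

/-- `RepData.rop` ((0.3) of the datum) does not depend on the instance. [cite: Balaban1989LargeFieldI, (0.3) p.176 (bookkeeping)] -/
theorem rop_instIrrel (i₁ i₂ : DecidableEq (PBond P j)) (d : RepData P j G) :
    (haveI := i₁; d.rop) = (haveI := i₂; d.rop) := by
  cases Subsingleton.elim i₁ i₂
  rfl

/-- FILE 6's `AdmissibleAE` does not depend on the instance. [cite: Balaban1989LargeFieldI, (0.3) p.176 (bookkeeping)] -/
theorem admissibleAE_instIrrel (i₁ i₂ : DecidableEq (PBond P j)) (rep : Density P j G → RepData P j G) (ρ : Density P j G) :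
    (haveI := i₁; AdmissibleAE rep ρ) ↔ (haveI := i₂; AdmissibleAE rep ρ) := by
  cases Subsingleton.elim i₁ i₂
  exact Iff.rfl

end InstIrrel

/-! ## §1  Proviso forms -/

section Form

variable {P : Params} {j : ℕ} {G : Type*} [GaugeGroup G] [MeasurableSpace G] [HaarData G]

/-- **A PROVISO FORM** for the (0.3) operation on one lattice: a predicate `Prov` on b01's representation data together with the two
certificates the totalised `R` consumes — (0.4) FOR THE DATUM (`∫ d.rop = ∫ d.total`) and integrability of `d.rop` — both conditional on
`Prov d`.  (The typed reading of [IV] p. 176 *«the densities are positive, and the integration domains … nonempty, hence the denominators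
are positive»* is a CHOICE; this structure is the slot for it.)  Parameterised by the `DecidableEq (PBond P j)` instance `d.rop` reads.
[cite: Balaban1989LargeFieldI, (0.3)–(0.4) p.176] -/
structure ProvisoForm (P : Params) (j : ℕ) (G : Type*) [GaugeGroup G] [MeasurableSpace G] [HaarData G]
    [DecidableEq (PBond P j)] where
  /-- the provisos read on the datum [cite: Balaban1989LargeFieldI, (0.3) p.176] -/
  Prov : RepData P j G → Prop
  /-- (0.4) for the datum under the provisos [cite: Balaban1989LargeFieldI, (0.4) p.176] -/
  integral_rop_eq : ∀ d : RepData P j G, Prov d →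
    ∫ V, d.rop V ∂(fieldMeasure P j G) = ∫ V, d.total V ∂(fieldMeasure P j G)
  /-- integrability of (0.3) under the provisos [cite: Balaban1989LargeFieldI, (0.3) p.176] -/
  integrable_rop : ∀ d : RepData P j G, Prov d → Integrable d.rop (fieldMeasure P j G)

variable [DecidableEq (PBond P j)]

/-- **THE STANDARD FORM** = b01's `RepData.Provisos` as typed (measurable, non-negative, uniformly bounded pieces; denominators NOWHERE
zero), with certificates b01's PROVED `integral_ropReal_eq` and `integrable_normTerm`. [cite: Balaban1989LargeFieldI, (0.3)–(0.4) p.176] -/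
def ProvisoForm.std : ProvisoForm P j G where
  Prov d := d.Provisos
  integral_rop_eq d h := by
    obtain ⟨hm, h0, ⟨C, hC⟩, hden⟩ := h
    letI := d.fin
    have h1 := B15.BasicStep.integral_ropReal_eq d.piece d.pp d.fib hm h0 hC hden
    unfold RepData.rop RepData.total
    rw [h1]
  integrable_rop d h := by
    obtain ⟨hm, h0, ⟨C, hC⟩, hden⟩ := h
    letI := d.fin
    have hterm : ∀ Z, Integrable (normTerm (d.fib Z) (d.piece (d.pp Z)) (d.piece Z)) (fieldMeasure P j G) :=
      fun Z => B15.BasicStep.integrable_normTerm _ (hm _) (hm _) (h0 _) (hC _) (hC _) (hden Z)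
    unfold RepData.rop B15.BasicStep.RopReal
    exact integrable_finsetSum _ fun Z _ => hterm Z

/-- The standard form's predicate is `RepData.Provisos`. [cite: Balaban1989LargeFieldI, (0.3) p.176 (bookkeeping)] -/
theorem ProvisoForm.std_prov_iff (d : RepData P j G) : (ProvisoForm.std : ProvisoForm P j G).Prov d ↔ d.Provisos := Iff.rfl

/-- Under the SUPPORT-form provisos the (0.3)-density of a representation datum is INTEGRABLE — each normalised term by dag-n10-b's
`integrable_normTerm_supp`, summed (the support-form twin of b01's `integrable_normTerm` chain ∕ dag-n23-a's `integrable_rop_of_provisos`).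
[cite: Balaban1989LargeFieldI, (0.3)–(0.4) p.176] -/
theorem integrable_rop_of_provisosSupp (d : RepData P j G) (h : d.ProvisosSupp) : Integrable d.rop (fieldMeasure P j G) := by
  obtain ⟨hm, h0, ⟨C, hC⟩, hsupp⟩ := h
  letI := d.fin
  have hterm : ∀ Z, Integrable (normTerm (d.fib Z) (d.piece (d.pp Z)) (d.piece Z)) (fieldMeasure P j G) :=
    fun Z => B15.BasicStep.integrable_normTerm_supp _ (hm _) (hm _) (h0 _) (hC _) (hC _) (hsupp Z)
  unfold RepData.rop B15.BasicStep.RopReal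
  exact integrable_finsetSum _ fun Z _ => hterm Z

/-- **THE SUPPORT FORM (v1.2 of record)** = dag-n10-b's `RepData.ProvisosSupp` (`B15FibreLemmaSupp`, p416095): measurable, non-negative,
uniformly bounded pieces, and *wherever a denominator fibre integral `∫dV′⌈_{Z′} ρ(Z″, ·)` vanishes, the numerator piece `ρ(Z, ·)` vanishes*
— print's p. 176 proviso read on the SUPPORT; certificates: n10-b's PROVED `integral_rop_eq_of_provisosSupp` ((0.4) for the datum) and
the finite sum of their `integrable_normTerm_supp`. [cite: Balaban1989LargeFieldI, (0.3)–(0.4) p.176; Balaban1989LargeFieldI, (1.102) p.201] -/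
def ProvisoForm.supp : ProvisoForm P j G where
  Prov d := d.ProvisosSupp
  integral_rop_eq d h := d.integral_rop_eq_of_provisosSupp h
  integrable_rop d h := integrable_rop_of_provisosSupp d h

/-- The support form's predicate is `RepData.ProvisosSupp`. [cite: Balaban1989LargeFieldI, (0.3) p.176 (bookkeeping)] -/
theorem ProvisoForm.supp_prov_iff (d : RepData P j G) :
    (ProvisoForm.supp : ProvisoForm P j G).Prov d ↔ d.ProvisosSupp := Iff.rfl

/-- The standard form implies the support form (n10-b's `provisosSupp_of_provisos`): v1.2 is admissible wherever v1.1 is.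
[cite: Balaban1989LargeFieldI, (0.3) p.176 (bookkeeping)] -/
theorem ProvisoForm.supp_of_std (d : RepData P j G) (h : (ProvisoForm.std : ProvisoForm P j G).Prov d) :
    (ProvisoForm.supp : ProvisoForm P j G).Prov d :=
  d.provisosSupp_of_provisos h

end Form

/-! ## §2  Admissibility and the total operator over a form -/

section Generic

variable {P : Params} {j : ℕ} {G : Type*} [GaugeGroup G] [MeasurableSpace G] [HaarData G]
variable [DecidableEq (PBond P j)]

/-- **Admissibility over the form `Φ`**: the datum represents `ρ` almost everywhere for `dV` and satisfies `Φ`'s provisos.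
[cite: Balaban1989LargeFieldI, (0.2)–(0.3) p.176] -/
def AdmissibleBy (Φ : ProvisoForm P j G) (rep : Density P j G → RepData P j G) (ρ : Density P j G) : Prop :=
  (rep ρ).total =ᵐ[fieldMeasure P j G] ρ ∧ Φ.Prov (rep ρ)

open Classical in
/-- **`R` totalised over the form `Φ`**: (0.3) of the datum on the `Φ`-admissible densities, the identity elsewhere (typing convention of
FILE 2 ∕ FILE 6, unchanged). [cite: Balaban1989LargeFieldI, (0.3) p.176] -/
def ropTotalBy (Φ : ProvisoForm P j G) (rep : Density P j G → RepData P j G) : Density P j G → Density P j G :=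
  fun ρ => if AdmissibleBy Φ rep ρ then (rep ρ).rop else ρ

open Classical in
/-- The admissible branch is the explicit (0.3). [cite: Balaban1989LargeFieldI, (0.3) p.176 (bookkeeping)] -/
theorem ropTotalBy_of_admissible {Φ : ProvisoForm P j G} {rep : Density P j G → RepData P j G} {ρ : Density P j G}
    (h : AdmissibleBy Φ rep ρ) : ropTotalBy Φ rep ρ = (rep ρ).rop :=
  if_pos h

open Classical in
/-- The other branch is the identity. [cite: Balaban1989LargeFieldI, (0.3) p.176 (typing convention)] -/
theorem ropTotalBy_of_not {Φ : ProvisoForm P j G} {rep : Density P j G → RepData P j G} {ρ : Density P j G}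
    (h : ¬ AdmissibleBy Φ rep ρ) : ropTotalBy Φ rep ρ = ρ :=
  if_neg h

/-- Introduction. [cite: Balaban1989LargeFieldI, (0.2)–(0.3) p.176 (bookkeeping)] -/
theorem admissibleBy_intro (Φ : ProvisoForm P j G) (rep : Density P j G → RepData P j G) (ρ : Density P j G)
    (hae : (rep ρ).total =ᵐ[fieldMeasure P j G] ρ) (hprov : Φ.Prov (rep ρ)) : AdmissibleBy Φ rep ρ :=
  ⟨hae, hprov⟩

/-- **Monotonicity in the form**: a weaker predicate admits more densities (e.g. standard ⇒ support form). [cite: Balaban1989LargeFieldI, (0.3) p.176 (bookkeeping)] -/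
theorem AdmissibleBy.mono {Φ Ψ : ProvisoForm P j G} (hΦΨ : ∀ d, Φ.Prov d → Ψ.Prov d)
    {rep : Density P j G → RepData P j G} {ρ : Density P j G} (h : AdmissibleBy Φ rep ρ) : AdmissibleBy Ψ rep ρ :=
  ⟨h.1, hΦΨ _ h.2⟩

/-- v1.2 is admissible wherever v1.1 is (one lattice). [cite: Balaban1989LargeFieldI, (0.3) p.176 (bookkeeping)] -/
theorem admissibleBy_supp_of_std {rep : Density P j G → RepData P j G} {ρ : Density P j G}
    (h : AdmissibleBy ProvisoForm.std rep ρ) : AdmissibleBy ProvisoForm.supp rep ρ :=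
  h.mono fun d hd => ProvisoForm.supp_of_std d hd

open Classical in
/-- **(0.4) FOR EVERY DENSITY over any form**: on the admissible branch the form's certificate gives `∫ rop = ∫ total` and the a.e. identity
finishes by `integral_congr_ae`; the other branch is the identity. [cite: Balaban1989LargeFieldI, (0.4) p.176] -/
theorem preservesIntegral_ropTotalBy (Φ : ProvisoForm P j G) (rep : Density P j G → RepData P j G) :
    PreservesIntegral (ropTotalBy Φ rep) := by
  intro ρ
  by_cases h : AdmissibleBy Φ rep ρ
  · rw [ropTotalBy_of_admissible h, Φ.integral_rop_eq _ h.2]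
    exact integral_congr_ae h.1
  · rw [ropTotalBy_of_not h]

open Classical in
/-- Integrability is preserved, for every density, over any form. [cite: Balaban1989LargeFieldI, (0.3)–(0.4) p.176 (bookkeeping)] -/
theorem integrable_ropTotalBy (Φ : ProvisoForm P j G) (rep : Density P j G → RepData P j G) {ρ : Density P j G}
    (hρ : Integrable ρ (fieldMeasure P j G)) : Integrable (ropTotalBy Φ rep ρ) (fieldMeasure P j G) := by
  by_cases h : AdmissibleBy Φ rep ρ
  · rw [ropTotalBy_of_admissible h]
    exact Φ.integrable_rop _ h.2
  · rw [ropTotalBy_of_not h]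
    exact hρ

/-- FILE 6's a.e. admissibility IS admissibility over the standard form (same instance). [cite: Balaban1989LargeFieldI, (0.3) p.176 (bookkeeping)] -/
theorem admissibleAE_iff_admissibleBy_std (rep : Density P j G → RepData P j G) (ρ : Density P j G) :
    AdmissibleAE rep ρ ↔ AdmissibleBy ProvisoForm.std rep ρ := Iff.rfl

end Generic

section GenericInstIrrel

variable {P : Params} {j : ℕ} {G : Type*} [GaugeGroup G] [MeasurableSpace G] [HaarData G]

/-- Admissibility over the standard form does not depend on the instance. [cite: Balaban1989LargeFieldI, (0.3) p.176 (bookkeeping)] -/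
theorem admissibleBy_std_instIrrel (i₁ i₂ : DecidableEq (PBond P j)) (rep : Density P j G → RepData P j G) (ρ : Density P j G) :
    (haveI := i₁; AdmissibleBy ProvisoForm.std rep ρ) ↔ (haveI := i₂; AdmissibleBy ProvisoForm.std rep ρ) := by
  cases Subsingleton.elim i₁ i₂
  exact Iff.rfl

/-- Admissibility over the support form does not depend on the instance. [cite: Balaban1989LargeFieldI, (0.3) p.176 (bookkeeping)] -/
theorem admissibleBy_supp_instIrrel (i₁ i₂ : DecidableEq (PBond P j)) (rep : Density P j G → RepData P j G) (ρ : Density P j G) :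
    (haveI := i₁; AdmissibleBy ProvisoForm.supp rep ρ) ↔ (haveI := i₂; AdmissibleBy ProvisoForm.supp rep ρ) := by
  cases Subsingleton.elim i₁ i₂
  exact Iff.rfl

/-- `ropTotalBy` over the standard form does not depend on the instance. [cite: Balaban1989LargeFieldI, (0.3) p.176 (bookkeeping)] -/
theorem ropTotalBy_std_instIrrel (i₁ i₂ : DecidableEq (PBond P j)) (rep : Density P j G → RepData P j G) :
    (haveI := i₁; ropTotalBy ProvisoForm.std rep) = (haveI := i₂; ropTotalBy ProvisoForm.std rep) := by
  cases Subsingleton.elim i₁ i₂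
  rfl

/-- `ropTotalBy` over the support form does not depend on the instance. [cite: Balaban1989LargeFieldI, (0.3) p.176 (bookkeeping)] -/
theorem ropTotalBy_supp_instIrrel (i₁ i₂ : DecidableEq (PBond P j)) (rep : Density P j G → RepData P j G) :
    (haveI := i₁; ropTotalBy ProvisoForm.supp rep) = (haveI := i₂; ropTotalBy ProvisoForm.supp rep) := by
  cases Subsingleton.elim i₁ i₂
  rfl

open Classical in
/-- FILE 6's `ropTotalAE` IS `ropTotalBy` over the standard form, at the classical instance FILE 6 baked (`rfl`).
[cite: Balaban1989LargeFieldI, (0.3) p.176 (bookkeeping)] -/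
theorem ropTotalAE_eq_ropTotalBy_std₀ (rep : Density P j G → RepData P j G) : ropTotalAE rep = ropTotalBy ProvisoForm.std rep := rfl

/-- FILE 6's `ropTotalAE` IS `ropTotalBy` over the standard form, at ANY instance. [cite: Balaban1989LargeFieldI, (0.3) p.176 (bookkeeping)] -/
theorem ropTotalAE_eq_ropTotalBy_std [DecidableEq (PBond P j)] (rep : Density P j G → RepData P j G) :
    ropTotalAE rep = ropTotalBy ProvisoForm.std rep :=
  (ropTotalAE_eq_ropTotalBy_std₀ rep).trans (ropTotalBy_std_instIrrel _ _ rep)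

end GenericInstIrrel

/-! ## §3  The NODE 00 pins over a form; v1.2 = the support form (TERMS of record, instance-closed) -/

section Pin

variable (F : T4Family) (N : ℕ) [NeZero N]

open Classical in
/-- A proviso form per run and step (the lattice and the level vary; the classical `DecidableEq (PBond …)` instance is fixed inside, TS-8 (ii)).
[cite: Balaban1989LargeFieldI, (0.3) p.176 (bookkeeping)] -/
abbrev ProvisoFormOfRecord : Type 1 :=
  (p : B12.RunParams) → (k : ℕ) → ProvisoForm (F.P p.K) (k + 1) (SU N)

open Classical in
/-- The standard form at every run and step. [cite: Balaban1989LargeFieldI, (0.3) p.176 (bookkeeping)] -/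
def ProvisoFormOfRecord.std : ProvisoFormOfRecord F N := fun _ _ => ProvisoForm.std

open Classical in
/-- The support form at every run and step (v1.2 of record). [cite: Balaban1989LargeFieldI, (0.3) p.176 (bookkeeping)] -/
def ProvisoFormOfRecord.supp : ProvisoFormOfRecord F N := fun _ _ => ProvisoForm.supp

open Classical in
/-- **`R` OF RECORD OVER THE FORM `Φ`** at the residual datum `rep` — fills `Residual₅.R`; with `Φ := ProvisoFormOfRecord.std` it is v1.1
(`ROp03AEOfRecord`, below `rfl`), with dag-n10-b's support form it is v1.2 (`ROp03SuppOfRecord`). [cite: Balaban1989LargeFieldI, (0.3) p.176] -/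
def ROp03ByOfRecord (Φ : ProvisoFormOfRecord F N) (rep : RepOfRecord F N) (p : B12.RunParams) (k : ℕ) :
    Density (F.P p.K) (k + 1) (SU N) → Density (F.P p.K) (k + 1) (SU N) :=
  ropTotalBy (Φ p k) (rep p k)

open Classical in
/-- Unfolding. [cite: Balaban1989LargeFieldI, (0.3) p.176 (bookkeeping)] -/
theorem ROp03ByOfRecord_eq (Φ : ProvisoFormOfRecord F N) (rep : RepOfRecord F N) (p : B12.RunParams) (k : ℕ) :
    ROp03ByOfRecord F N Φ rep p k = ropTotalBy (Φ p k) (rep p k) := rfl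

/-- **v1.1 IS the standard form** (`rfl`). [cite: Balaban1989LargeFieldI, (0.3) p.176 (bookkeeping)] -/
theorem ROp03ByOfRecord_std (rep : RepOfRecord F N) :
    ROp03ByOfRecord F N (ProvisoFormOfRecord.std F N) rep = ROp03AEOfRecord F N rep := rfl

/-- **`R` OF RECORD (v1.2) — THE ₇ PLUG OF RECORD** = the pin over the SUPPORT form: `Residual.R := ROp03SuppOfRecord F N rep` (admissible
wherever v1.1 is, and also on genuine indicator data whose denominators vanish off the support). [cite: Balaban1989LargeFieldI, (0.3) p.176] -/
def ROp03SuppOfRecord (rep : RepOfRecord F N) (p : B12.RunParams) (k : ℕ) :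
    Density (F.P p.K) (k + 1) (SU N) → Density (F.P p.K) (k + 1) (SU N) :=
  ROp03ByOfRecord F N (ProvisoFormOfRecord.supp F N) rep p k

/-- Unfolding of v1.2. [cite: Balaban1989LargeFieldI, (0.3) p.176 (bookkeeping)] -/
theorem ROp03SuppOfRecord_eq (rep : RepOfRecord F N) :
    ROp03SuppOfRecord F N rep = ROp03ByOfRecord F N (ProvisoFormOfRecord.supp F N) rep := rfl

/-- v1.2 at ANY instance: `R` of record (v1.2) is `ropTotalBy ProvisoForm.supp` of the datum read with the consumer's instance (TS-8 (iii)).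
[cite: Balaban1989LargeFieldI, (0.3) p.176 (bookkeeping)] -/
theorem ROp03SuppOfRecord_eq_ropTotalBy (rep : RepOfRecord F N) (p : B12.RunParams) (k : ℕ) [DecidableEq (PBond (F.P p.K) (k + 1))] :
    ROp03SuppOfRecord F N rep p k = ropTotalBy ProvisoForm.supp (rep p k) :=
  ropTotalBy_supp_instIrrel _ _ (rep p k)

/-- v1.1 at ANY instance, likewise. [cite: Balaban1989LargeFieldI, (0.3) p.176 (bookkeeping)] -/
theorem ROp03AEOfRecord_eq_ropTotalBy (rep : RepOfRecord F N) (p : B12.RunParams) (k : ℕ) [DecidableEq (PBond (F.P p.K) (k + 1))] :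
    ROp03AEOfRecord F N rep p k = ropTotalBy ProvisoForm.std (rep p k) :=
  ropTotalAE_eq_ropTotalBy_std (rep p k)

open Classical in
/-- **(0.4) for `R` of record over any form, every run, step and density** — fills `Residual₅.preservesIntegral_R` (guard unused).
[cite: Balaban1989LargeFieldI, (0.4) p.176] -/
theorem preservesIntegral_ROp03ByOfRecord (Φ : ProvisoFormOfRecord F N) (rep : RepOfRecord F N) :
    ∀ (p : B12.RunParams) (k : ℕ), k < p.K → PreservesIntegral (ROp03ByOfRecord F N Φ rep p k) :=
  fun p k _ => preservesIntegral_ropTotalBy (Φ p k) (rep p k)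

open Classical in
/-- (0.4) without the guard. [cite: Balaban1989LargeFieldI, (0.4) p.176] -/
theorem preservesIntegral_ROp03ByOfRecord' (Φ : ProvisoFormOfRecord F N) (rep : RepOfRecord F N) (p : B12.RunParams) (k : ℕ) :
    PreservesIntegral (ROp03ByOfRecord F N Φ rep p k) :=
  preservesIntegral_ropTotalBy (Φ p k) (rep p k)

open Classical in
/-- **Integrability is preserved** — fills `Residual₅.integrable_R`. [cite: Balaban1989LargeFieldI, (0.3)–(0.4) p.176 (bookkeeping)] -/
theorem integrable_ROp03ByOfRecord (Φ : ProvisoFormOfRecord F N) (rep : RepOfRecord F N) :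
    ∀ (p : B12.RunParams) (k : ℕ), k < p.K → ∀ ρ : Density (F.P p.K) (k + 1) (SU N),
      Integrable ρ (fieldMeasure (F.P p.K) (k + 1) (SU N)) →
        Integrable (ROp03ByOfRecord F N Φ rep p k ρ) (fieldMeasure (F.P p.K) (k + 1) (SU N)) :=
  fun p k _ _ hρ => integrable_ropTotalBy (Φ p k) (rep p k) hρ

/-- **(0.4) for THE PLUG** `ROp03SuppOfRecord` — `Residual.preservesIntegral_R := preservesIntegral_ROp03SuppOfRecord F N rep`.
[cite: Balaban1989LargeFieldI, (0.4) p.176] -/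
theorem preservesIntegral_ROp03SuppOfRecord (rep : RepOfRecord F N) :
    ∀ (p : B12.RunParams) (k : ℕ), k < p.K → PreservesIntegral (ROp03SuppOfRecord F N rep p k) :=
  preservesIntegral_ROp03ByOfRecord F N _ rep

/-- (0.4) for the plug without the guard. [cite: Balaban1989LargeFieldI, (0.4) p.176] -/
theorem preservesIntegral_ROp03SuppOfRecord' (rep : RepOfRecord F N) (p : B12.RunParams) (k : ℕ) :
    PreservesIntegral (ROp03SuppOfRecord F N rep p k) :=
  preservesIntegral_ROp03ByOfRecord' F N _ rep p k

/-- **Integrability for THE PLUG** — `Residual.integrable_R := integrable_ROp03SuppOfRecord F N rep`. [cite: Balaban1989LargeFieldI, (0.3)–(0.4) p.176 (bookkeeping)] -/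
theorem integrable_ROp03SuppOfRecord (rep : RepOfRecord F N) :
    ∀ (p : B12.RunParams) (k : ℕ), k < p.K → ∀ ρ : Density (F.P p.K) (k + 1) (SU N),
      Integrable ρ (fieldMeasure (F.P p.K) (k + 1) (SU N)) →
        Integrable (ROp03SuppOfRecord F N rep p k ρ) (fieldMeasure (F.P p.K) (k + 1) (SU N)) :=
  integrable_ROp03ByOfRecord F N _ rep

open Classical in
/-- The admissible branch is the explicit (0.3) (form and datum read at the instance of record). [cite: Balaban1989LargeFieldI, (0.3) p.176 (bookkeeping)] -/
theorem ROp03ByOfRecord_of_admissibleBy {Φ : ProvisoFormOfRecord F N} {rep : RepOfRecord F N} {p : B12.RunParams} {k : ℕ}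
    {ρ : Density (F.P p.K) (k + 1) (SU N)} (h : AdmissibleBy (Φ p k) (rep p k) ρ) :
    ROp03ByOfRecord F N Φ rep p k ρ = (rep p k ρ).rop :=
  ropTotalBy_of_admissible h

open Classical in
/-- The other branch is the identity. [cite: Balaban1989LargeFieldI, (0.3) p.176 (typing convention)] -/
theorem ROp03ByOfRecord_of_not {Φ : ProvisoFormOfRecord F N} {rep : RepOfRecord F N} {p : B12.RunParams} {k : ℕ}
    {ρ : Density (F.P p.K) (k + 1) (SU N)} (h : ¬ AdmissibleBy (Φ p k) (rep p k) ρ) :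
    ROp03ByOfRecord F N Φ rep p k ρ = ρ :=
  ropTotalBy_of_not h

/-- THE PLUG on its admissible branch, stated at the consumer's instance (TS-8 (iii)). [cite: Balaban1989LargeFieldI, (0.3) p.176 (bookkeeping)] -/
theorem ROp03SuppOfRecord_of_admissibleBy {rep : RepOfRecord F N} {p : B12.RunParams} {k : ℕ} [DecidableEq (PBond (F.P p.K) (k + 1))]
    {ρ : Density (F.P p.K) (k + 1) (SU N)} (h : AdmissibleBy ProvisoForm.supp (rep p k) ρ) :
    ROp03SuppOfRecord F N rep p k ρ = (rep p k ρ).rop := by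
  rw [ROp03SuppOfRecord_eq_ropTotalBy]
  exact ropTotalBy_of_admissible h

/-- THE PLUG off its admissible branch, at the consumer's instance. [cite: Balaban1989LargeFieldI, (0.3) p.176 (typing convention)] -/
theorem ROp03SuppOfRecord_of_not {rep : RepOfRecord F N} {p : B12.RunParams} {k : ℕ} [DecidableEq (PBond (F.P p.K) (k + 1))]
    {ρ : Density (F.P p.K) (k + 1) (SU N)} (h : ¬ AdmissibleBy ProvisoForm.supp (rep p k) ρ) :
    ROp03SuppOfRecord F N rep p k ρ = ρ := by
  rw [ROp03SuppOfRecord_eq_ropTotalBy]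
  exact ropTotalBy_of_not h

end Pin

/-! ## §4  Tower corollaries over a form (form and datum read at the instance of record) -/

section TowerPin

variable (F : T4Family) (N : ℕ) [NeZero N]

open Classical in
/-- Under the a.e. identity and the form's provisos the tower's datum (FILE 6 `repOfDataAE`) is admissible over the form.
[cite: Balaban1989LargeFieldI, (0.3) p.176 (bookkeeping)] -/
theorem admissibleBy_repOfDataAE_of_ae (Φ : ProvisoFormOfRecord F N) (T : RepDataTower F N) {p : B12.RunParams} {k : ℕ}
    {ρ : Density (F.P p.K) (k + 1) (SU N)} (hae : (T p k).total =ᵐ[fieldMeasure (F.P p.K) (k + 1) (SU N)] ρ)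
    (hprov : (Φ p k).Prov (T p k)) : AdmissibleBy (Φ p k) (repOfDataAE F N T p k) ρ := by
  refine ⟨?_, ?_⟩ <;> rw [repOfDataAE_of_ae F N T hae]
  exacts [hae, hprov]

open Classical in
/-- **On a density a.e.-equal to the tower's total, under the form's provisos, `R` of record over the form IS the explicit (0.3) of the tower.**
[cite: Balaban1989LargeFieldI, (0.3) p.176] -/
theorem ROp03ByOfRecord_repOfDataAE_of_ae (Φ : ProvisoFormOfRecord F N) (T : RepDataTower F N) {p : B12.RunParams} {k : ℕ}
    {ρ : Density (F.P p.K) (k + 1) (SU N)} (hae : (T p k).total =ᵐ[fieldMeasure (F.P p.K) (k + 1) (SU N)] ρ)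
    (hprov : (Φ p k).Prov (T p k)) : ROp03ByOfRecord F N Φ (repOfDataAE F N T) p k ρ = (T p k).rop := by
  rw [ROp03ByOfRecord_of_admissibleBy F N (admissibleBy_repOfDataAE_of_ae F N Φ T hae hprov), repOfDataAE_of_ae F N T hae]

open Classical in
/-- The same at the tower OF RECORD (FILE 5 `repOfRecordAE` ∕ `towerOfRecord`). [cite: Balaban1989LargeFieldI, (0.3)–(0.4) p.176] -/
theorem ROp03ByOfRecord_repOfRecordAE_of_ae (Φ : ProvisoFormOfRecord F N) (ν : Stage7Numerics) (τ : TowerNumerics)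
    (texpA : TexpAOfRecord F N ν τ.M) (ppSel : PpSelOfRecord F ν τ.M) (gsel : B12.RunParams → ℕ → ℝ) (p : B12.RunParams) (k : ℕ)
    {ρ : Density (F.P p.K) (k + 1) (SU N)}
    (hae : (towerOfRecord F N ν τ texpA ppSel gsel p k).toRepData.total =ᵐ[fieldMeasure (F.P p.K) (k + 1) (SU N)] ρ)
    (hprov : (Φ p k).Prov (towerOfRecord F N ν τ texpA ppSel gsel p k).toRepData) :
    ROp03ByOfRecord F N Φ (repOfRecordAE F N ν τ texpA ppSel gsel) p k ρ
      = (towerOfRecord F N ν τ texpA ppSel gsel p k).toRepData.rop :=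
  ROp03ByOfRecord_repOfDataAE_of_ae F N Φ _ hae hprov

end TowerPin

/-! ## §5  Consumer faces at the consumer's instance (TS-8 (iii)): THE PLUG's tower faces under `ProvisosSupp`, and binder-form twins of
the FILE 5 ∕ FILE 8 faces -/

section Faces

variable (F : T4Family) (N : ℕ) [NeZero N] (ν : Stage7Numerics) (τ : TowerNumerics)

/-- FILE 8's `rop_towerRepOfRecord_eq_densityOfSlice` at the consumer's instance: (0.3) of the tower of record IS the slice density of the
R-stepped slot. [cite: Balaban1989LargeFieldI, (0.3) p.176; Balaban1988Convergent, (2.18) p.257] -/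
theorem rop_towerRepOfRecord_eq_densityOfSlice' (texpA : TexpAOfRecord F N ν τ.M) (ppSel : PpSelOfRecord F ν τ.M)
    (p : B12.RunParams) (g : ℕ → ℝ) (k : ℕ) [DecidableEq (PBond (F.P p.K) k)] :
    (towerRepOfRecord F N ν τ texpA ppSel p g k).toRepData.rop
      = densityOfSlice F N ν τ.M p g k (rstepSlotOfRecord F N ν τ ppSel p g k (texpA p g k)) :=
  (rop_instIrrel _ _ _).trans (rop_towerRepOfRecord_eq_densityOfSlice F N ν τ texpA ppSel p g k)

/-- FILE 8's `integral_densityOfSlice_rstepSlotOfRecord` ((0.4) at a slot family, standard form) at the consumer's instance.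
[cite: Balaban1989LargeFieldI, (0.4) p.176] -/
theorem integral_densityOfSlice_rstepSlotOfRecord' (texpA : TexpAOfRecord F N ν τ.M) (ppSel : PpSelOfRecord F ν τ.M)
    (p : B12.RunParams) (g : ℕ → ℝ) (k : ℕ) [DecidableEq (PBond (F.P p.K) k)]
    (hprov : (towerRepOfRecord F N ν τ texpA ppSel p g k).toRepData.Provisos) :
    ∫ V, densityOfSlice F N ν τ.M p g k (rstepSlotOfRecord F N ν τ ppSel p g k (texpA p g k)) V ∂(fieldMeasure (F.P p.K) k (SU N))
      = ∫ V, densityOfRepr F N ν τ.M texpA p g k V ∂(fieldMeasure (F.P p.K) k (SU N)) :=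
  integral_densityOfSlice_rstepSlotOfRecord F N ν τ texpA ppSel p g k ((provisos_instIrrel _ _ _).1 hprov)

/-- **(0.4) AT A SLOT FAMILY UNDER THE SUPPORT FORM** (the face node00-def-T's `integral_rhoOfRecord9_succ` twin under `ProvisosSupp` cites):
under `ProvisosSupp` of the tower of record at level `k`, the slice density of the R-stepped slot and the represented density of the slot
have equal integrals — dag-n10-b's PROVED `integral_rop_eq_of_provisosSupp` at the tower datum, whose (0.3) is the slice density of the
R-stepped slot (FILE 8) and whose total is the represented density (FILE 5, `rfl`). [cite: Balaban1989LargeFieldI, (0.4) p.176] -/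
theorem integral_densityOfSlice_rstepSlotOfRecord_of_provisosSupp (texpA : TexpAOfRecord F N ν τ.M) (ppSel : PpSelOfRecord F ν τ.M)
    (p : B12.RunParams) (g : ℕ → ℝ) (k : ℕ) [DecidableEq (PBond (F.P p.K) k)]
    (hprov : (towerRepOfRecord F N ν τ texpA ppSel p g k).toRepData.ProvisosSupp) :
    ∫ V, densityOfSlice F N ν τ.M p g k (rstepSlotOfRecord F N ν τ ppSel p g k (texpA p g k)) V ∂(fieldMeasure (F.P p.K) k (SU N))
      = ∫ V, densityOfRepr F N ν τ.M texpA p g k V ∂(fieldMeasure (F.P p.K) k (SU N)) := by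
  rw [← rop_towerRepOfRecord_eq_densityOfSlice' F N ν τ texpA ppSel p g k]
  have h := (towerRepOfRecord F N ν τ texpA ppSel p g k).toRepData.integral_rop_eq_of_provisosSupp hprov
  rw [TowerRep.toRepData_total, towerRepOfRecord_total] at h
  exact h

/-- **INTEGRABILITY AT A SLOT FAMILY UNDER THE SUPPORT FORM**: under `ProvisosSupp` of the tower of record at level `k`, the slice density of
the R-stepped slot (= `ρ_k` of the recursion for `k ≥ 1`) is integrable (consumer's instance; the support-form twin of dag-n23-a's
`integrable_towerOfRecord9_ρ_succ` input). [cite: Balaban1989LargeFieldI, (0.3)–(0.4) p.176] -/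
theorem integrable_densityOfSlice_rstepSlotOfRecord_of_provisosSupp (texpA : TexpAOfRecord F N ν τ.M) (ppSel : PpSelOfRecord F ν τ.M)
    (p : B12.RunParams) (g : ℕ → ℝ) (k : ℕ) [DecidableEq (PBond (F.P p.K) k)]
    (hprov : (towerRepOfRecord F N ν τ texpA ppSel p g k).toRepData.ProvisosSupp) :
    Integrable (densityOfSlice F N ν τ.M p g k (rstepSlotOfRecord F N ν τ ppSel p g k (texpA p g k))) (fieldMeasure (F.P p.K) k (SU N)) := by
  rw [← rop_towerRepOfRecord_eq_densityOfSlice' F N ν τ texpA ppSel p g k]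
  exact integrable_rop_of_provisosSupp _ hprov

/-- FILE 5's `ROp03AEOfRecord_repOfRecordAE_of_ae` (v1.1, standard form) at the consumer's instance. [cite: Balaban1989LargeFieldI, (0.3)–(0.4) p.176] -/
theorem ROp03AEOfRecord_repOfRecordAE_of_ae' (texpA : TexpAOfRecord F N ν τ.M) (ppSel : PpSelOfRecord F ν τ.M)
    (gsel : B12.RunParams → ℕ → ℝ) (p : B12.RunParams) (k : ℕ) [DecidableEq (PBond (F.P p.K) (k + 1))]
    {ρ : Density (F.P p.K) (k + 1) (SU N)}
    (hae : (towerOfRecord F N ν τ texpA ppSel gsel p k).toRepData.total =ᵐ[fieldMeasure (F.P p.K) (k + 1) (SU N)] ρ)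
    (hprov : (towerOfRecord F N ν τ texpA ppSel gsel p k).toRepData.Provisos) :
    ROp03AEOfRecord F N (repOfRecordAE F N ν τ texpA ppSel gsel) p k ρ
      = (towerOfRecord F N ν τ texpA ppSel gsel p k).toRepData.rop :=
  (ROp03AEOfRecord_repOfRecordAE_of_ae F N ν τ texpA ppSel gsel p k hae ((provisos_instIrrel _ _ _).1 hprov)).trans
    (rop_instIrrel _ _ _)

/-- FILE 8's `ROp03AEOfRecord_repOfRecordAE_eq_densityOfSlice` (v1.1) at the consumer's instance. [cite: Balaban1989LargeFieldI, (0.3)–(0.4) p.176; Balaban1988Convergent, Theorem 1 p.262] -/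
theorem ROp03AEOfRecord_repOfRecordAE_eq_densityOfSlice' (texpA : TexpAOfRecord F N ν τ.M) (ppSel : PpSelOfRecord F ν τ.M)
    (gsel : B12.RunParams → ℕ → ℝ) (p : B12.RunParams) (k : ℕ) [DecidableEq (PBond (F.P p.K) (k + 1))]
    {ρ : Density (F.P p.K) (k + 1) (SU N)}
    (hae : (towerOfRecord F N ν τ texpA ppSel gsel p k).toRepData.total =ᵐ[fieldMeasure (F.P p.K) (k + 1) (SU N)] ρ)
    (hprov : (towerOfRecord F N ν τ texpA ppSel gsel p k).toRepData.Provisos) :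
    ROp03AEOfRecord F N (repOfRecordAE F N ν τ texpA ppSel gsel) p k ρ
      = densityOfSlice F N ν τ.M p (gsel p) (k + 1)
          (rstepSlotOfRecord F N ν τ ppSel p (gsel p) (k + 1) (texpA p (gsel p) (k + 1))) :=
  (ROp03AEOfRecord_repOfRecordAE_of_ae' F N ν τ texpA ppSel gsel p k hae hprov).trans
    (rop_towerRepOfRecord_eq_densityOfSlice' F N ν τ texpA ppSel p (gsel p) (k + 1))

/-- **THE PLUG at a tower carried as `RepData`**: on a density a.e.-equal to the tower's total, under `ProvisosSupp` (consumer's instance),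
`R` of record (v1.2) IS the explicit (0.3) of the tower. [cite: Balaban1989LargeFieldI, (0.3) p.176] -/
theorem ROp03SuppOfRecord_repOfDataAE_of_ae (T : RepDataTower F N) {p : B12.RunParams} {k : ℕ} [DecidableEq (PBond (F.P p.K) (k + 1))]
    {ρ : Density (F.P p.K) (k + 1) (SU N)} (hae : (T p k).total =ᵐ[fieldMeasure (F.P p.K) (k + 1) (SU N)] ρ)
    (hprov : (T p k).ProvisosSupp) : ROp03SuppOfRecord F N (repOfDataAE F N T) p k ρ = (T p k).rop :=
  (ROp03ByOfRecord_repOfDataAE_of_ae F N (ProvisoFormOfRecord.supp F N) T hae ((provisosSupp_instIrrel _ _ _).1 hprov)).trans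
    (rop_instIrrel _ _ _)

/-- **THE PLUG at the tower OF RECORD**: on a density a.e.-equal to the record's represented density after `k + 1` steps, under `ProvisosSupp`
of the tower datum (consumer's instance), `R` of record (v1.2) IS the explicit (0.3) of the tower of record. [cite: Balaban1989LargeFieldI, (0.3)–(0.4) p.176] -/
theorem ROp03SuppOfRecord_repOfRecordAE_of_ae (texpA : TexpAOfRecord F N ν τ.M) (ppSel : PpSelOfRecord F ν τ.M)
    (gsel : B12.RunParams → ℕ → ℝ) (p : B12.RunParams) (k : ℕ) [DecidableEq (PBond (F.P p.K) (k + 1))]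
    {ρ : Density (F.P p.K) (k + 1) (SU N)}
    (hae : (towerOfRecord F N ν τ texpA ppSel gsel p k).toRepData.total =ᵐ[fieldMeasure (F.P p.K) (k + 1) (SU N)] ρ)
    (hprov : (towerOfRecord F N ν τ texpA ppSel gsel p k).toRepData.ProvisosSupp) :
    ROp03SuppOfRecord F N (repOfRecordAE F N ν τ texpA ppSel gsel) p k ρ
      = (towerOfRecord F N ν τ texpA ppSel gsel p k).toRepData.rop :=
  ROp03SuppOfRecord_repOfDataAE_of_ae F N (fun p k => (towerOfRecord F N ν τ texpA ppSel gsel p k).toRepData) hae hprov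

/-- **THE PLUG maps the represented density of a slot family to the slice density of its R-stepped slot**: with FILE 5's (R3) pin
`repOfRecordAE` fed the slot family `texpA` (node00-def-T: the PRE-𝐑 family, level `k+1` = `𝐓ρ_k`'s slots), `R` of record (v1.2) sends
every density a.e.-equal to the represented density at level `k+1` to the slice density of the R-stepped slot (= `ρ_{k+1}` of the
recursion), under `ProvisosSupp` of the tower datum (consumer's instance). [cite: Balaban1989LargeFieldI, (0.3)–(0.4) p.176; Balaban1988Convergent, Theorem 1 p.262] -/
theorem ROp03SuppOfRecord_repOfRecordAE_eq_densityOfSlice (texpA : TexpAOfRecord F N ν τ.M) (ppSel : PpSelOfRecord F ν τ.M)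
    (gsel : B12.RunParams → ℕ → ℝ) (p : B12.RunParams) (k : ℕ) [DecidableEq (PBond (F.P p.K) (k + 1))]
    {ρ : Density (F.P p.K) (k + 1) (SU N)}
    (hae : (towerOfRecord F N ν τ texpA ppSel gsel p k).toRepData.total =ᵐ[fieldMeasure (F.P p.K) (k + 1) (SU N)] ρ)
    (hprov : (towerOfRecord F N ν τ texpA ppSel gsel p k).toRepData.ProvisosSupp) :
    ROp03SuppOfRecord F N (repOfRecordAE F N ν τ texpA ppSel gsel) p k ρ
      = densityOfSlice F N ν τ.M p (gsel p) (k + 1)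
          (rstepSlotOfRecord F N ν τ ppSel p (gsel p) (k + 1) (texpA p (gsel p) (k + 1))) :=
  (ROp03SuppOfRecord_repOfRecordAE_of_ae F N ν τ texpA ppSel gsel p k hae hprov).trans
    (rop_towerRepOfRecord_eq_densityOfSlice' F N ν τ texpA ppSel p (gsel p) (k + 1))

/-- **(0.4) for THE PLUG at the tower of record, in slot form**: under the a.e. identity and `ProvisosSupp`, `∫ R ρ dV = ∫ (represented density) dV`
(the plug's (0.4) for every density composed with the a.e. identity; no proviso needed for the left identity, stated for the consumer's bookkeeping).
[cite: Balaban1989LargeFieldI, (0.4) p.176] -/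
theorem integral_ROp03SuppOfRecord_repOfRecordAE (texpA : TexpAOfRecord F N ν τ.M) (ppSel : PpSelOfRecord F ν τ.M)
    (gsel : B12.RunParams → ℕ → ℝ) (p : B12.RunParams) (k : ℕ) {ρ : Density (F.P p.K) (k + 1) (SU N)}
    (hae : (towerOfRecord F N ν τ texpA ppSel gsel p k).toRepData.total =ᵐ[fieldMeasure (F.P p.K) (k + 1) (SU N)] ρ) :
    ∫ V, ROp03SuppOfRecord F N (repOfRecordAE F N ν τ texpA ppSel gsel) p k ρ V ∂(fieldMeasure (F.P p.K) (k + 1) (SU N))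
      = ∫ V, densityOfRepr F N ν τ.M texpA p (gsel p) (k + 1) V ∂(fieldMeasure (F.P p.K) (k + 1) (SU N)) := by
  rw [preservesIntegral_ROp03SuppOfRecord' F N (repOfRecordAE F N ν τ texpA ppSel gsel) p k ρ]
  exact (integral_congr_ae hae).symm

end Faces

end Literature.MathematicalPhysics.QuantumFieldTheory.Balaban1983to89.Node00

end
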